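import Summits.QuantumFields.BalabanUV.Beta.GAN24.CombCubicStepTransport
import Summits.QuantumFields.BalabanUV.Beta.SymCorrectorRest
import Summits.QuantumFields.BalabanUV.Beta.KernelWardCoarseExchange
import Summits.QuantumFields.BalabanUV.Beta.RecursiveWSlot

/-!
# `BalabanUV.Beta.GAN24.CombQuarticStepTransport` — binder row G-an2-4 ∕ (CONV-C), TRANSFER-III (the G-an2-4 END at row D1's literal of record (III′)), W-SLOT SIDE,
# THE STRUCTURAL BRICK (twin of road-P2's `CombCubicStepTransport`; the OWNER gan24-p1 g46's NOTE N-gan24p1-g46-1 (Q1) made a tree line at the level of the READ-OUT):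
# **THE QUARTIC STEP OF THE COMB-CHART RESOLVENT IS THE QUARTIC STEP OF THE ROOTED bm STEP RESOLVENT ON TRANSPORTED TABLES —
# `e4OfKW Lc (GcombSh Lc j) S M W = e4OfKW Lc G_j (𝒯 S) (𝒯′ M) (𝒯′ W)`, `G_j = coDressKBmAt ρ_c Lc (KInvStep Lc j)`, with ONE fixed slot-and-leg transport `𝒯 S := κ u ↦ Ψ̂_Sᵀ∘slotPsiS S κ u∘Ψ̂_S`
# on the first-order field tables and ONE fixed leg transport `𝒯′ X := Ψ̂_Sᵀ ∘ X ∘ Ψ̂_S` on the multiplier tables and on the carrier — hence the (III′) T₂-tower `T2RecOf … (GcombSh Lc) …`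
# runs the (E) quartic level maps `e4OfKW Lc G_j` on transported running tables**
# (G-an2-4 CRUX TEAM (2), seat `b2b-balaban-gan24-p2` = road-P2 chair, gen 55)

NOT IN PRINT; OUR BOOKKEEPING ([folklore] tame-kernel bookkeeping BY NAME over road-P2 M.43 `CombCubicStepTransport` (§1 `mm`-read corrector-blindness pattern, §2 the congruence of
`vertexOfK` into its slot), d1-formalise-leaf-03 gen 29's `SymCorrectorRest.{vertexOfM_conj_psiKS, dM_conj_psiKS, K2OfK_conj_psiKS, conj_psiKS_inr_inr'}` (road BF-x's (D-R) words),
an5's `KernelWardCoarseExchange.{comp_cwsum, cwsum_comp, comp_add_of_bdd, add_comp_of_bdd, abs_comp_le_of_spr_left, abs_cwsum_le}` ∕ `TameKernelCalculus`, an2's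
`CombChartTransportLevel.GcombSh_eq_conj_psiKS_KInvStep`, `RecursiveWSlot.T2RecOf_succ`, the Literature's `BalabanStepW2.K3OfK` ∕ `SecondOrderResponse`; 0 `def`, 0 cited fact,
0 `def … : Prop`, 0 sorry).
HONEST FRAMING (cell contract, verbatim): «discharging `BetaPertH` makes Bałaban's UV stability UNCONDITIONAL — a real constructive-QFT result; it is NOT the continuum
limit and NOT the Clay problem.»  HONEST DEPENDENCY (verbatim): «continuum YM on T⁴ ⇐ BetaPertH ∧ nine spine estimates (0/9 proved); BetaPertH ⇐ (D1) ∧ (D4) ∧ CAP+tail;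
G-an2-4 gates asym, D1 and NE2/3/4.»
ABSOLUTE RULE (cell charter, verbatim): «No internally-minted statement may enter as a cited fact. Every hypothesis is either kernel-proved in this package or a
verbatim quotation of a PUBLISHED theorem with page reference. The manuscript(s) under audit are NOT citable for their own disputed steps — they are the thing under
adjudication; programme-internal (2001/route/tribunal) claims are never citable.»  Nothing is cited here.

## Why (context only; asserted nowhere below)
`T2RecOf … (j+1) = (cE₂·wV4 (j+1)) • e4OfKW Lc G′_j S′_j (tabs.M j) (WcombOf … j) + (cB·wB2 (j+1)) • tabs.vh₂S` with `e4OfKW Lc K S M W b b′ = mmRead Lc (K3OfK K Lc S M W b b′)` and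
`K3OfK K … = −K∘dM(b)∘K2(b′) − K∘dM(b′)∘K2(b) − K∘W(b,b′)∘K`.  d1-leaf-03 computed the (D-R) words of a `Ψ̂`-conjugate: `K2OfK (Ψ̂KΨ̂ᵀ) = Ψ̂ ∘ (−(K ∘ (Ψ̂ᵀ∘dM(Ψ̂KΨ̂ᵀ)∘Ψ̂) ∘ K)) ∘ Ψ̂ᵀ`,
`dM (Ψ̂KΨ̂ᵀ) n S M = vertexOfK K n (slotPsiS S) + vertexOfM K n M`.  As for the cubic step, the `mm`-read drops the OUTER correctors of each of the three words, and the INNER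
`Ψ̂ᵀ ∘ · ∘ Ψ̂` land on the tables: on the field slot as `𝒯` (slot + legs), on the multiplier slot as the leg congruence `𝒯′` only (`Ψ̂`'s multiplier block is `1`: the multiplier
column does not see the corrector — leaf-03 (i)), on the carrier as `𝒯′`.  So `e4OfKW Lc (Ψ̂KΨ̂ᵀ) S M W = e4OfKW Lc K (𝒯 S) (𝒯′ M) (𝒯′ W)`.

## What is proved (generic `d`)
* §1 `mmRead_conj_psiKS` (NO hypothesis: `mmRead M (Ψ̂∘X∘Ψ̂ᵀ) = mmRead M X`); `mmRead` through `−` ∕ subtraction is an3's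
  `VertexReflectionContact.mmRead_neg` ∕ leaf-05's `ThirdJetKernel.mmRead_sub` BY NAME (leaf-04 g76 X-CQST NIT N-Q1).
* §2 **`conj_vertexOfM_eq_vertexOfM_conj`** (spread `P`, decaying `K`, bounded `M`: `Pᵀ ∘ vertexOfM K N M μ y ∘ P = vertexOfM K N (ρ w ↦ Pᵀ∘M ρ w∘P) μ y`),
  **`conj_dM_eq_dM_conj`** (`Pᵀ ∘ dM K N S M b ∘ P = dM K N (κ u ↦ Pᵀ∘S κ u∘P) (ρ w ↦ Pᵀ∘M ρ w∘P) b` for local `S`, vertex-family `M`).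
* §3 **`e4OfKW_conj_psiKS`**: spread `K`, local `S` (`0 < δ`), vertex family `M` (`0 < δ`), localised carrier slices `W b b′`, `0 < n`, `r ∈ box`:
  `e4OfKW n (Ψ̂∘K∘Ψ̂ᵀ) S M W b b′ = e4OfKW n K (κ u ↦ Ψ̂ᵀ∘slotPsiS r n S κ u∘Ψ̂) (ρ w ↦ Ψ̂ᵀ∘M ρ w∘Ψ̂) (μ y ν y′ ↦ Ψ̂ᵀ∘W μ y ν y′∘Ψ̂) b b′`.
* §4 THE (III′) INSTANCE: **`e4OfKW_GcombSh_eq_bm_transport`** and the T₂-recursion consequence **`T2RecOf_comb_succ_eq_bm_transport`**: for ANY sym record and pins,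
  `T2RecOf d Lc (GcombSh Lc) (SpureCombOf tabs …) tabs.M cE₂ cB T tabs.vh₂S tabs.mixFF (j+1) = (cE₂·wV4 (j+1)) • e4OfKW Lc G_j (𝒯 S′_j) (𝒯′ (tabs.M j)) (𝒯′ (WcombOf … j)) + (cB·wB2 (j+1)) • tabs.vh₂S`.
WHAT THIS IS NOT: the carrier `WcombOf … j` inside `𝒯′` is NOT itself re-expressed (its word-by-word transport is d1-leaf-03's `SymCorrectorLiteralW.W2SymOfK_conj_psiKS`); no row of the
W-slot, NO value, NO rate; NO campaign opened (an2 W-4 l.64553 stands); NEVER «G-an2-4 closed» as (CONV-C); NOT D1, NOT `BetaPertH`, NOT continuum, NOT Clay.  2026-08-25; no existing file touched.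
-/

noncomputable section

open Finset
open scoped BigOperators
open Literature.MathematicalPhysics.QuantumFieldTheory
open Literature.MathematicalPhysics.QuantumFieldTheory.Balaban1983to89
open Literature.MathematicalPhysics.QuantumFieldTheory.Balaban1983to89.Beta
open ExpKernelCalculus (MKer Decays BiLoc VertexFamily comp biLoc_comp_decays Zl)
open KernelWard (bdd_of_biLoc comp_finset_sum_right comp_finset_sum_left)
open AffineAveraging (Site box toSite)
open AveragingContoursRooted (ctr ctrOff ctrOff_mem_box)
open OneStepResolventKernel (Fib wsum LocStencil)
open OneStepKernelFamily (KInvStep colH vertexOfK)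
open InterLevelTransport (cwsum)
open BalabanStepJetsSucc (mmRead mmRead_inl_inl mmRead_inr_left mmRead_inr_right wE wVH wΛ E2 lamCoeffK)
open SecondOrderResponse (colM vertexOfM dM dM_apply K2OfK vertexFamily_dM)
open BalabanStepW2 (K3OfK wV4 wB2 M2Of)
open Summit.QuantumFields.BalabanUV.Beta.TameKernelCalculus
open Summit.QuantumFields.BalabanUV.Beta.ChartConjugationRelative (spr_comp)
open Summit.QuantumFields.BalabanUV.Beta.ChartConjugationReflection (vertexOfK_eq_sum summable_abs_colH loc_wsum_colH abs_le_of_locStencil)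
open Summit.QuantumFields.BalabanUV.Beta.WardLocusSecondOrder (summable_abs_colM)
open Summit.QuantumFields.BalabanUV.Beta.KernelWardCoarseExchange (comp_cwsum cwsum_comp comp_add_of_bdd add_comp_of_bdd abs_comp_le_of_spr_left abs_cwsum_le)
open Summit.QuantumFields.BalabanUV.Beta.KernelWardRelative (loc_finset_sum)
open Summit.QuantumFields.BalabanUV.Beta.BorderedHessian (spr_KInvStep)
open Summit.QuantumFields.BalabanUV.Beta.AxialDressingRooted (coDressKBmAt spr_coDressKBmAt one_le_of_neZero)
open Summit.QuantumFields.BalabanUV.Beta.SpineRooted (e4OfKW SpureRecOf T2RecOf T2RecOf_succ WrecOf)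
open Summit.QuantumFields.BalabanUV.Beta.SymmetrisedStepJets (SymTables)
open Summit.QuantumFields.BalabanUV.Beta.SymCorrectorKernel (psiKS comp_psiKS_inr comp_trK_psiKS_inr spr_psiKS)
open Summit.QuantumFields.BalabanUV.Beta.SymCorrectorFace (slotPsiS)
open Summit.QuantumFields.BalabanUV.Beta.SymCorrectorSockets (locStencil_slotPsiS)
open Summit.QuantumFields.BalabanUV.Beta.SymCorrectorRest (conj_psiKS_inr_inr' vertexOfM_conj_psiKS dM_conj_psiKS K2OfK_conj_psiKS)
open Summit.QuantumFields.BalabanUV.Beta.CombChartStepJets (GcombSh ScombOf SpureCombOf WcombOf WcombOf_eq SpureCombOf_eq locStencil_SpureCombOf vertexFamily₂_WcombOf)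
open Summit.QuantumFields.BalabanUV.Beta.CombChartTransportLevel (GcombSh_eq_conj_psiKS_KInvStep)
open Summit.QuantumFields.BalabanUV.Beta.GAN24.CombCubicStepTransport (conj_vertexOfK_eq_vertexOfK_conj)
open Summit.QuantumFields.BalabanUV.Beta.VertexReflectionContact (mmRead_neg)
open Summit.QuantumFields.BalabanUV.Beta.GAN24.ThirdJetKernel (mmRead_sub)

namespace Summit.QuantumFields.BalabanUV.Beta.GAN24.CombQuarticStepTransport

variable {d : ℕ}

/-! ## §1 The `mm`-read of a `Ψ̂`-conjugate; `mmRead` through `−` -/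

section MM

variable (r : Fin (d + 1) → ℕ) (n : ℕ)

/-- [folklore] **THE `mm`-READ DOES NOT SEE THE CORRECTORS**: `mmRead M (Ψ̂ ∘ X ∘ Ψ̂ᵀ) = mmRead M X` for ANY `X` (leaf-03's `conj_psiKS_inr_inr'`: the multiplier–multiplier block of a
`Ψ̂`-conjugate is the kernel's; NO hypothesis). -/
theorem mmRead_conj_psiKS (M : ℕ) (X : MKer (d + 1) (Fib d)) :
    mmRead M (comp (comp (psiKS r n) X) (trK (psiKS r n))) = mmRead M X := by
  funext x' z' a b
  rcases a with α | μ
  · rcases b with β | ν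
    · rw [mmRead_inl_inl, mmRead_inl_inl, conj_psiKS_inr_inr']
    · rw [mmRead_inr_right, mmRead_inr_right]
  · rw [mmRead_inr_left, mmRead_inr_left]

end MM

/-! ## §2 Congruences of the multiplier vertex and of `dM` move into the tables -/

section Vertex

variable {N : ℕ} [NeZero N]

/-- NOT IN PRINT; OUR BOOKKEEPING ([folklore]; the congruence twin of an5's `vertexOfM_conjV`).  **`Pᵀ ∘ vertexOfM K N M μ y ∘ P = vertexOfM K N (ρ w ↦ Pᵀ∘M ρ w∘P) μ y`**
for a spread `P`, a decaying `K` and a uniformly bounded multiplier family `M` (two exchanges per multiplier slot; the finite slot sum by `comp_add_of_bdd ∕ add_comp_of_bdd`). -/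
theorem conj_vertexOfM_eq_vertexOfM_conj {P K : MKer (d + 1) (Fib d)} (hP : Spr P) (hK : ∃ δ C : ℝ, 0 < δ ∧ 0 ≤ C ∧ Decays K C δ)
    {M : Fin (d + 1) → (Fin (d + 1) → ℤ) → MKer (d + 1) (Fib d)} {B : ℝ} (hB : ∀ ρ w x z a b, |M ρ w x z a b| ≤ B)
    (μ : Fin (d + 1)) (y : Fin (d + 1) → ℤ) :
    comp (comp (trK P) (vertexOfM K N M μ y)) P = vertexOfM K N (fun ρ w => comp (comp (trK P) (M ρ w)) P) μ y := by
  obtain ⟨CP, δP, hδP, hPd⟩ := id hP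
  have hPt : Spr (trK P) := hP.trK
  have hB0 : 0 ≤ B := (abs_nonneg _).trans (hB 0 0 0 0 (Sum.inl 0) (Sum.inl 0))
  -- uniform bounds: `Pᵀ ∘ M ρ w` by `BX`; the coarse superpositions by `(Σ'|colM|)·B`, their `Pᵀ`-images by the (ρ-dependent) constant `BXs ρ`
  set BX : ℝ := (Fintype.card (Fib d) : ℝ) * CP * Zl (d + 1) δP * B with hBX
  have hPM : ∀ ρ w x z a b, |comp (trK P) (M ρ w) x z a b| ≤ BX := fun ρ w => abs_comp_le_of_spr_left (decays_trK hPd) hδP (hB ρ w)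
  have hBX0 : 0 ≤ BX := (abs_nonneg _).trans (hPM 0 0 0 0 (Sum.inl 0) (Sum.inl 0))
  have hw := summable_abs_colM (N := N) hK μ y
  have hC : ∀ ρ x z a b, |cwsum N (colM K N μ y ρ) (M ρ) x z a b| ≤ (∑' w, |colM K N μ y ρ w|) * B := fun ρ => abs_cwsum_le (hw ρ) (hB ρ)
  have hPC : ∀ ρ x z a b, |comp (trK P) (cwsum N (colM K N μ y ρ) (M ρ)) x z a b| ≤ (Fintype.card (Fib d) : ℝ) * CP * Zl (d + 1) δP * ((∑' w, |colM K N μ y ρ w|) * B) :=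
    fun ρ => abs_comp_le_of_spr_left (decays_trK hPd) hδP (hC ρ)
  -- termwise in the multiplier slot
  have e : ∀ ρ, comp (comp (trK P) (cwsum N (colM K N μ y ρ) (M ρ))) P = cwsum N (colM K N μ y ρ) (fun w => comp (comp (trK P) (M ρ w)) P) := fun ρ => by
    rw [comp_cwsum hPt (hw ρ) hB0 (hB ρ), cwsum_comp hP (hw ρ) hBX0 (hPM ρ)]
  have eVS : ∀ T : Fin (d + 1) → (Fin (d + 1) → ℤ) → MKer (d + 1) (Fib d), vertexOfM K N T μ y = ∑ ρ, cwsum N (colM K N μ y ρ) (T ρ) :=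
    fun T => by funext x z a b; simp only [vertexOfM, Finset.sum_apply]
  rw [eVS (fun ρ w => comp (comp (trK P) (M ρ w)) P), eVS M]
  simp only [← e]
  -- the congruence through the finite multiplier-slot sum
  have hsum : ∀ (s : Finset (Fin (d + 1))),
      comp (comp (trK P) (∑ ρ ∈ s, cwsum N (colM K N μ y ρ) (M ρ))) P = ∑ ρ ∈ s, comp (comp (trK P) (cwsum N (colM K N μ y ρ) (M ρ))) P
      ∧ (∀ x z a b, |(∑ ρ ∈ s, cwsum N (colM K N μ y ρ) (M ρ)) x z a b| ≤ ∑ ρ ∈ s, (∑' w, |colM K N μ y ρ w|) * B)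
      ∧ (∀ x z a b, |(comp (trK P) (∑ ρ ∈ s, cwsum N (colM K N μ y ρ) (M ρ))) x z a b|
          ≤ ∑ ρ ∈ s, (Fintype.card (Fib d) : ℝ) * CP * Zl (d + 1) δP * ((∑' w, |colM K N μ y ρ w|) * B)) := by
    intro s
    induction s using Finset.induction_on with
    | empty =>
      refine ⟨?_, fun x z a b => by simp, fun x z a b => ?_⟩
      · funext x z a b; simp [ExpKernelCalculus.comp]
      · simp [ExpKernelCalculus.comp]
    | insert ρ s hρ ih =>
      obtain ⟨ih1, ih2, ih3⟩ := ih
      rw [Finset.sum_insert hρ, Finset.sum_insert hρ, Finset.sum_insert hρ, Finset.sum_insert hρ]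
      have hL : comp (trK P) (cwsum N (colM K N μ y ρ) (M ρ) + ∑ ρ ∈ s, cwsum N (colM K N μ y ρ) (M ρ))
          = comp (trK P) (cwsum N (colM K N μ y ρ) (M ρ)) + comp (trK P) (∑ ρ ∈ s, cwsum N (colM K N μ y ρ) (M ρ)) :=
        comp_add_of_bdd hPt (hC ρ) ih2
      refine ⟨?_, fun x z a b => ?_, fun x z a b => ?_⟩
      · rw [hL, add_comp_of_bdd hP (hPC ρ) ih3, ih1]
      · rw [Pi.add_apply, Pi.add_apply, Pi.add_apply, Pi.add_apply]
        exact (abs_add_le _ _).trans (add_le_add (hC ρ x z a b) (ih2 x z a b))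
      · rw [hL, Pi.add_apply, Pi.add_apply, Pi.add_apply, Pi.add_apply]
        exact (abs_add_le _ _).trans (add_le_add (hPC ρ x z a b) (ih3 x z a b))
  exact (hsum Finset.univ).1

/-- NOT IN PRINT; OUR BOOKKEEPING ([folklore]).  **THE CONGRUENCE OF `dM` MOVES INTO BOTH TABLES**: for a spread `P`, a decaying `K`, a local stencil family `S` and a multiplier
vertex family `M` (both at a positive radius), `Pᵀ ∘ dM K N S M b ∘ P = dM K N (κ u ↦ Pᵀ∘S κ u∘P) (ρ w ↦ Pᵀ∘M ρ w∘P) b`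
(road-P2's `conj_vertexOfK_eq_vertexOfK_conj` + `conj_vertexOfM_eq_vertexOfM_conj`, the two vertices being localised). -/
theorem conj_dM_eq_dM_conj {P K : MKer (d + 1) (Fib d)} (hP : Spr P) (hK : ∃ δ C : ℝ, 0 < δ ∧ 0 ≤ C ∧ Decays K C δ)
    {S : Fin (d + 1) → (Fin (d + 1) → ℤ) → MKer (d + 1) (Fib d)} {Cs δs : ℝ} (hS : LocStencil S Cs δs) (hδs : 0 < δs)
    {M : Fin (d + 1) → (Fin (d + 1) → ℤ) → MKer (d + 1) (Fib d)} {CM δM : ℝ} (hM : VertexFamily M N CM δM) (hδM : 0 < δM)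
    (μ : Fin (d + 1)) (y : Fin (d + 1) → ℤ) :
    comp (comp (trK P) (dM K N S M μ y)) P
      = dM K N (fun κ u => comp (comp (trK P) (S κ u)) P) (fun ρ w => comp (comp (trK P) (M ρ w)) P) μ y := by
  obtain ⟨δK, CK, hδK, hCK, hKd⟩ := hK
  have hPt : Spr (trK P) := hP.trK
  have hMb : ∀ ρ w x z a b, |M ρ w x z a b| ≤ CM := fun ρ w x z a b => bdd_of_biLoc (hM ρ w) hδM.le x z a b
  -- both vertices are localised
  have hV : Loc (vertexOfK K N S μ y) := by
    rw [vertexOfK_eq_sum]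
    exact loc_finset_sum _ fun κ' => loc_wsum_colH (N := N) ⟨δK, CK, hδK, hCK, hKd⟩ hS hδs μ y κ'
  have hW : Loc (vertexOfM K N M μ y) := by
    set m : ℝ := min δK δM with hm
    have hm0 : 0 < m := lt_min hδK hδM
    have hKm : Decays K CK m := OneStepResolventKernel.decays_mono hKd hCK le_rfl (min_le_left _ _)
    have hMm : VertexFamily M N CM m := fun ρ w => OneStepResolventKernel.biLoc_mono (hM ρ w) ((hM 0 0).nonneg (Sum.inl 0)) (min_le_right _ _)
    have h := SecondOrderResponse.vertexFamily_vertexOfM hKm hCK hMm hm0 le_rfl μ y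
    exact ⟨_, _, _, _, half_pos hm0, h⟩
  have e : dM K N S M μ y = vertexOfK K N S μ y + vertexOfM K N M μ y := by funext x z a b; rfl
  rw [e, comp_add_right_tame hPt.tame hV.tame hW.tame, comp_add_left_tame (hPt.comp_loc hV).tame (hPt.comp_loc hW).tame hP.tame,
    conj_vertexOfK_eq_vertexOfK_conj hP ⟨δK, CK, hδK, hCK, hKd⟩ hS hδs μ y, conj_vertexOfM_eq_vertexOfM_conj hP ⟨δK, CK, hδK, hCK, hKd⟩ hMb μ y]
  funext x z a b; rfl

end Vertex

/-! ## §3 The quartic step of a `Ψ̂`-conjugated kernel -/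

section Quartic

variable {n : ℕ} (hn : 0 < n) {r : Fin (d + 1) → ℕ} (hr : r ∈ box (d + 1) n)
include hn hr

/-- NOT IN PRINT; OUR BOOKKEEPING ([folklore]; THE STRUCTURAL BRICK, W-SIDE).  **THE QUARTIC STEP OF A `Ψ̂`-CONJUGATED KERNEL IS THE QUARTIC STEP ON TRANSPORTED TABLES**:
for spread `K`, a local stencil family `S` (`0 < δ`), a multiplier vertex family `M` (`0 < δ`), a carrier `W` with localised slices, `0 < n`, `r ∈ box (d+1) n`, `Ψ̂ := psiKS r n`, all `b b′`:
`e4OfKW n (Ψ̂∘K∘Ψ̂ᵀ) S M W b b′ = e4OfKW n K (κ u ↦ Ψ̂ᵀ∘slotPsiS r n S κ u∘Ψ̂) (ρ w ↦ Ψ̂ᵀ∘M ρ w∘Ψ̂) (μ y ν y′ ↦ Ψ̂ᵀ∘W μ y ν y′∘Ψ̂) b b′`.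
(leaf-03's `K2OfK_conj_psiKS ∕ dM_conj_psiKS`; the three words of `K3OfK` re-associated to `Ψ̂ ∘ (·) ∘ Ψ̂ᵀ`; §1 drops the outer correctors; §2 moves the inner ones into the tables.) -/
theorem e4OfKW_conj_psiKS {K : MKer (d + 1) (Fib d)} (hK : Spr K)
    {S : Fin (d + 1) → (Fin (d + 1) → ℤ) → MKer (d + 1) (Fib d)} {Cs δs : ℝ} (hS : LocStencil S Cs δs) (hδs : 0 < δs)
    {M : Fin (d + 1) → (Fin (d + 1) → ℤ) → MKer (d + 1) (Fib d)} {CM δM : ℝ} (hM : VertexFamily M n CM δM) (hδM : 0 < δM)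
    {W : Fin (d + 1) → (Fin (d + 1) → ℤ) → Fin (d + 1) → (Fin (d + 1) → ℤ) → MKer (d + 1) (Fib d)} (hW : ∀ μ y ν y', Loc (W μ y ν y'))
    (μ : Fin (d + 1)) (y : Fin (d + 1) → ℤ) (ν : Fin (d + 1)) (y' : Fin (d + 1) → ℤ) :
    e4OfKW n (comp (comp (psiKS r n) K) (trK (psiKS r n))) S M W μ y ν y'
      = e4OfKW n K (fun κ u => comp (comp (trK (psiKS r n)) (slotPsiS r n S κ u)) (psiKS r n))
          (fun ρ w => comp (comp (trK (psiKS r n)) (M ρ w)) (psiKS r n))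
          (fun μ y ν y' => comp (comp (trK (psiKS r n)) (W μ y ν y')) (psiKS r n)) μ y ν y' := by
  haveI : NeZero n := ⟨hn.ne'⟩
  set P : MKer (d + 1) (Fib d) := psiKS r n with hP
  set K' : MKer (d + 1) (Fib d) := comp (comp P K) (trK P) with hK'def
  have hΨ : Spr P := spr_psiKS hn hr
  have hΨt : Spr (trK P) := hΨ.trK
  have hK2 : ∃ δ C : ℝ, 0 < δ ∧ 0 ≤ C ∧ Decays K C δ := by
    obtain ⟨C, δ, hδ, hKd⟩ := hK
    exact ⟨δ, |C|, hδ, abs_nonneg C, decays_of_le hKd le_rfl⟩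
  have hK' : Spr K' := spr_comp (spr_comp hΨ hK) hΨt
  have hK'2 : ∃ δ C : ℝ, 0 < δ ∧ 0 ≤ C ∧ Decays K' C δ := by
    obtain ⟨C, δ, hδ, hKd⟩ := hK'
    exact ⟨δ, |C|, hδ, abs_nonneg C, decays_of_le hKd le_rfl⟩
  -- the slot-transported field table and the transported tables
  have hT := locStencil_slotPsiS (d := d) hn r hS hδs.le
  -- `dM` of the conjugated kernel at both bonds: localised, and read on `K`
  have hMb : ∀ ρ w x z a b, |M ρ w x z a b| ≤ CM := fun ρ w x z a b => bdd_of_biLoc (hM ρ w) hδM.le x z a b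
  have hDloc : ∀ (μ : Fin (d + 1)) (y : Fin (d + 1) → ℤ), Loc (dM K' n S M μ y) := by
    intro μ y
    obtain ⟨C', δ', hδ', hK'd⟩ := hK'
    set m : ℝ := min δ' (min δs δM) with hm
    have hm0 : 0 < m := lt_min hδ' (lt_min hδs hδM)
    have hC' : 0 ≤ |C'| := abs_nonneg _
    have hKm : Decays K' (|C'|) m := decays_of_le hK'd (min_le_left _ _)
    have hSm : LocStencil S Cs m := fun κ u => OneStepResolventKernel.biLoc_mono (hS κ u) ((hS 0 0).nonneg (Sum.inl 0))
      ((min_le_right _ _).trans (min_le_left _ _))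
    have hMm : VertexFamily M n CM m := fun ρ w => OneStepResolventKernel.biLoc_mono (hM ρ w) ((hM 0 0).nonneg (Sum.inl 0))
      ((min_le_right _ _).trans (min_le_right _ _))
    have h := vertexFamily_dM hKm hC' hSm hMm hm0 le_rfl μ y
    exact ⟨_, _, _, _, half_pos hm0, h⟩
  have hD : ∀ (μ : Fin (d + 1)) (y : Fin (d + 1) → ℤ), dM K' n S M μ y = dM K n (slotPsiS r n S) M μ y := by
    intro μ y
    rw [hK'def, hP, dM_conj_psiKS hn hr hK hS hδs M μ y]
    funext x z a b; rfl
  -- the transported `dM`: `Ψ̂ᵀ ∘ dM K n (slotPsiS S) M b ∘ Ψ̂ = dM K n (𝒯 S) (𝒯′ M) b`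
  have hDhat : ∀ (μ : Fin (d + 1)) (y : Fin (d + 1) → ℤ),
      comp (comp (trK P) (dM K' n S M μ y)) P
        = dM K n (fun κ u => comp (comp (trK P) (slotPsiS r n S κ u)) P) (fun ρ w => comp (comp (trK P) (M ρ w)) P) μ y := by
    intro μ y
    rw [hD μ y, hP]
    exact conj_dM_eq_dM_conj hΨ hK2 hT hδs hM hδM μ y
  -- abbreviations
  set D₁ : MKer (d + 1) (Fib d) := dM K' n S M μ y with hD₁
  set D₂ : MKer (d + 1) (Fib d) := dM K' n S M ν y' with hD₂
  have hD₁loc : Loc D₁ := hDloc μ y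
  have hD₂loc : Loc D₂ := hDloc ν y'
  -- the inner kernels `Y_b := −(K ∘ (Ψ̂ᵀ∘D_b∘Ψ̂) ∘ K)`
  have hPtD₁ : Loc (comp (trK P) D₁) := hΨt.comp_loc hD₁loc
  have hPtD₂ : Loc (comp (trK P) D₂) := hΨt.comp_loc hD₂loc
  have hPtD₁P : Loc (comp (comp (trK P) D₁) P) := hPtD₁.comp_spr hΨ
  have hPtD₂P : Loc (comp (comp (trK P) D₂) P) := hPtD₂.comp_spr hΨ
  have hKD₁ : Loc (comp K (comp (comp (trK P) D₁) P)) := hK.comp_loc hPtD₁P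
  have hKD₂ : Loc (comp K (comp (comp (trK P) D₂) P)) := hK.comp_loc hPtD₂P
  have hY₁loc : Loc (-(comp (comp K (comp (comp (trK P) D₁) P)) K)) := (hKD₁.comp_spr hK).neg
  have hY₂loc : Loc (-(comp (comp K (comp (comp (trK P) D₂) P)) K)) := (hKD₂.comp_spr hK).neg
  -- K2 of the conjugated kernel (leaf-03)
  have hK2₁ : K2OfK K' n S M μ y = comp (comp P (-(comp (comp K (comp (comp (trK P) D₁) P)) K))) (trK P) := by
    rw [hK'def, hP]; exact K2OfK_conj_psiKS hn hr hK S M μ y (hDloc μ y)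
  have hK2₂ : K2OfK K' n S M ν y' = comp (comp P (-(comp (comp K (comp (comp (trK P) D₂) P)) K))) (trK P) := by
    rw [hK'def, hP]; exact K2OfK_conj_psiKS hn hr hK S M ν y' (hDloc ν y')
  -- the sandwich word `K′ ∘ X ∘ (Ψ̂ ∘ Y ∘ Ψ̂ᵀ) = Ψ̂ ∘ ((K ∘ (Ψ̂ᵀ∘X∘Ψ̂)) ∘ Y) ∘ Ψ̂ᵀ` for localised `X` and `Y` localised or `Y = K`
  have hPK : Spr (comp P K) := spr_comp hΨ hK
  have word : ∀ {X Y : MKer (d + 1) (Fib d)}, Loc X → Tame Y → Tame (comp P Y) → Tame (comp (comp P Y) (trK P)) →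
      Tame (comp (comp K (comp (comp (trK P) X) P)) Y) →
      comp (comp K' X) (comp (comp P Y) (trK P)) = comp (comp P (comp (comp K (comp (comp (trK P) X) P)) Y)) (trK P) := by
    intro X Y hX hY hPY hB hZ
    have hPtX : Loc (comp (trK P) X) := hΨt.comp_loc hX
    have hA : Loc (comp K (comp (trK P) X)) := hK.comp_loc hPtX
    have h1 : comp K' X = comp P (comp K (comp (trK P) X)) := by
      rw [hK'def, ← comp_assoc_tame hPK.tame hΨt.tame hX.tame, ← comp_assoc_tame hΨ.tame hK.tame hPtX.tame]
    have hAB : comp (comp K (comp (trK P) X)) (comp (comp P Y) (trK P)) = comp (comp (comp K (comp (comp (trK P) X) P)) Y) (trK P) := by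
      rw [comp_assoc_tame hA.tame hPY hΨt.tame, comp_assoc_tame hA.tame hΨ.tame hY, ← comp_assoc_tame hK.tame hPtX.tame hΨ.tame]
    rw [h1, ← comp_assoc_tame hΨ.tame hA.tame hB, hAB, comp_assoc_tame hΨ.tame hZ hΨt.tame]
  -- the carrier word `K′ ∘ W ∘ K′ = Ψ̂ ∘ ((K ∘ (Ψ̂ᵀ∘W∘Ψ̂)) ∘ K) ∘ Ψ̂ᵀ`
  have wordW : comp (comp K' (W μ y ν y')) K' = comp (comp P (comp (comp K (comp (comp (trK P) (W μ y ν y')) P)) K)) (trK P) := by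
    have hX := hW μ y ν y'
    have hKm : Loc (comp K (comp (comp (trK P) (W μ y ν y')) P)) := hK.comp_loc ((hΨt.comp_loc hX).comp_spr hΨ)
    have hK't : Tame K' := hK'.tame
    rw [hK'def] at hK't ⊢
    exact word hX hK.tame hPK.tame hK't (hKm.comp_spr hK).tame
  -- assemble
  show mmRead n (K3OfK K' n S M W μ y ν y') = mmRead n (K3OfK K n _ _ _ μ y ν y')
  have eK3 : ∀ (A : MKer (d + 1) (Fib d)) (S₁ M₁ : Fin (d + 1) → (Fin (d + 1) → ℤ) → MKer (d + 1) (Fib d))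
      (W₁ : Fin (d + 1) → (Fin (d + 1) → ℤ) → Fin (d + 1) → (Fin (d + 1) → ℤ) → MKer (d + 1) (Fib d)),
      K3OfK A n S₁ M₁ W₁ μ y ν y' = -comp (comp A (dM A n S₁ M₁ μ y)) (K2OfK A n S₁ M₁ ν y') - comp (comp A (dM A n S₁ M₁ ν y')) (K2OfK A n S₁ M₁ μ y)
          - comp (comp A (W₁ μ y ν y')) A := fun A S₁ M₁ W₁ => by funext x z a b; rfl
  have eK2 : ∀ (A : MKer (d + 1) (Fib d)) (S₁ M₁ : Fin (d + 1) → (Fin (d + 1) → ℤ) → MKer (d + 1) (Fib d)) (ν₁ : Fin (d + 1)) (y₁ : Fin (d + 1) → ℤ),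
      K2OfK A n S₁ M₁ ν₁ y₁ = -comp (comp A (dM A n S₁ M₁ ν₁ y₁)) A := fun A S₁ M₁ ν₁ y₁ => by funext x z a b; rfl
  rw [eK3 K', eK3 K, ← hD₁, ← hD₂, hK2₁, hK2₂, word hD₁loc hY₂loc.tame (hΨ.comp_loc hY₂loc).tame ((hΨ.comp_loc hY₂loc).comp_spr hΨt).tame (hKD₁.comp hY₂loc).tame,
    word hD₂loc hY₁loc.tame (hΨ.comp_loc hY₁loc).tame ((hΨ.comp_loc hY₁loc).comp_spr hΨt).tame (hKD₂.comp hY₁loc).tame, wordW,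
    mmRead_sub, mmRead_sub, mmRead_neg, mmRead_conj_psiKS, mmRead_conj_psiKS, mmRead_conj_psiKS,
    mmRead_sub, mmRead_sub, mmRead_neg, eK2 K, eK2 K, hDhat μ y, hDhat ν y']

end Quartic

/-! ## §4 The (III′) instance: the comb-chart quartic step and the T₂-recursion -/

section Comb

variable {Lc : ℕ} [NeZero Lc]

/-- NOT IN PRINT; OUR BOOKKEEPING ([folklore]; THE (III′) QUARTIC STEP).  **`e4OfKW Lc (GcombSh Lc j) S M W = e4OfKW Lc G_j (𝒯 S) (𝒯′ M) (𝒯′ W)`** at every bond pair, with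
`G_j = coDressKBmAt ρ_c Lc (KInvStep Lc j)`, `Ψ̂_S = psiKS (ctrOff (d+1) Lc) Lc`, `𝒯 S κ u := Ψ̂_Sᵀ∘slotPsiS (ctrOff (d+1) Lc) Lc S κ u∘Ψ̂_S`, `𝒯′ X := Ψ̂_Sᵀ∘X∘Ψ̂_S` — the SAME transports
at EVERY level (an2's `GcombSh_eq_conj_psiKS_KInvStep` ⨾ §3). -/
theorem e4OfKW_GcombSh_eq_bm_transport (j : ℕ)
    {S : Fin (d + 1) → (Fin (d + 1) → ℤ) → MKer (d + 1) (Fib d)} {Cs δs : ℝ} (hS : LocStencil S Cs δs) (hδs : 0 < δs)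
    {M : Fin (d + 1) → (Fin (d + 1) → ℤ) → MKer (d + 1) (Fib d)} {CM δM : ℝ} (hM : VertexFamily M Lc CM δM) (hδM : 0 < δM)
    {W : Fin (d + 1) → (Fin (d + 1) → ℤ) → Fin (d + 1) → (Fin (d + 1) → ℤ) → MKer (d + 1) (Fib d)} (hW : ∀ μ y ν y', Loc (W μ y ν y'))
    (μ : Fin (d + 1)) (y : Fin (d + 1) → ℤ) (ν : Fin (d + 1)) (y' : Fin (d + 1) → ℤ) :
    e4OfKW Lc (GcombSh (d := d) Lc j) S M W μ y ν y'
      = e4OfKW Lc (coDressKBmAt (ctr (d + 1) Lc) Lc (KInvStep (d := d) Lc j))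
          (fun κ u => comp (comp (trK (psiKS (ctrOff (d + 1) Lc) Lc)) (slotPsiS (ctrOff (d + 1) Lc) Lc S κ u)) (psiKS (ctrOff (d + 1) Lc) Lc))
          (fun ρ w => comp (comp (trK (psiKS (ctrOff (d + 1) Lc) Lc)) (M ρ w)) (psiKS (ctrOff (d + 1) Lc) Lc))
          (fun μ y ν y' => comp (comp (trK (psiKS (ctrOff (d + 1) Lc) Lc)) (W μ y ν y')) (psiKS (ctrOff (d + 1) Lc) Lc)) μ y ν y' := by
  have hLc : 0 < Lc := Nat.pos_of_ne_zero (NeZero.ne Lc)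
  have hr : ctrOff (d + 1) Lc ∈ box (d + 1) Lc := ctrOff_mem_box hLc
  rw [GcombSh_eq_conj_psiKS_KInvStep Lc j]
  exact e4OfKW_conj_psiKS hLc hr (spr_coDressKBmAt hLc hr (spr_KInvStep j)) hS hδs hM hδM hW μ y ν y'

/-- NOT IN PRINT; OUR BOOKKEEPING ([folklore]; THE (III′) T₂-RECURSION READ ON THE bm CHART).  **THE COMB-CHART T₂-TOWER RUNS THE (E) QUARTIC LEVEL MAPS ON TRANSPORTED
RUNNING TABLES**: for ANY sym record `tabs : SymTables d Lc`, ANY pins `cE cVH cΛ cE₂ cB T`, every level and every bond pair,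
`T2RecOf d Lc (GcombSh Lc) (SpureCombOf tabs cE cVH cΛ) tabs.M cE₂ cB T tabs.vh₂S tabs.mixFF (j+1) κ u κ′ u′
   = (cE₂·wV4 (j+1)) • e4OfKW Lc G_j (𝒯 (SpureCombOf tabs … j)) (𝒯′ (tabs.M j)) (𝒯′ (WcombOf tabs … j)) κ u κ′ u′ + (cB·wB2 (j+1)) • tabs.vh₂S κ u κ′ u′`
(an2's `T2RecOf_succ` ⨾ `e4OfKW_GcombSh_eq_bm_transport` with an2's `locStencil_SpureCombOf`, the record's (LM) and `vertexFamily₂_WcombOf`).  Compare (E): the SAME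
`e4OfKW Lc G_j` on `(SpureRecAt j, M1At j, WrecAt j)`. -/
theorem T2RecOf_comb_succ_eq_bm_transport (tabs : SymTables d Lc) (cE cVH cΛ cE₂ cB : ℝ) (T : Fin 4 → Fin 4 → Fin 4 → Fin 4 → ℝ) (j : ℕ)
    (κ : Fin (d + 1)) (u : Fin (d + 1) → ℤ) (κ' : Fin (d + 1)) (u' : Fin (d + 1) → ℤ) :
    T2RecOf d Lc (GcombSh Lc) (SpureCombOf tabs cE cVH cΛ) tabs.M cE₂ cB T tabs.vh₂S tabs.mixFF (j + 1) κ u κ' u'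
      = (cE₂ * wV4 d Lc (j + 1)) •
          e4OfKW Lc (coDressKBmAt (ctr (d + 1) Lc) Lc (KInvStep (d := d) Lc j))
            (fun κ u => comp (comp (trK (psiKS (ctrOff (d + 1) Lc) Lc)) (slotPsiS (ctrOff (d + 1) Lc) Lc (SpureCombOf tabs cE cVH cΛ j) κ u))
              (psiKS (ctrOff (d + 1) Lc) Lc))
            (fun ρ w => comp (comp (trK (psiKS (ctrOff (d + 1) Lc) Lc)) (tabs.M j ρ w)) (psiKS (ctrOff (d + 1) Lc) Lc))
            (fun μ y ν y' => comp (comp (trK (psiKS (ctrOff (d + 1) Lc) Lc)) (WcombOf tabs cE cVH cΛ cE₂ cB T j μ y ν y')) (psiKS (ctrOff (d + 1) Lc) Lc))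
            κ u κ' u' +
        (cB * wB2 d Lc (j + 1)) • tabs.vh₂S κ u κ' u' := by
  obtain ⟨Cs, δs, hδs, hS⟩ := locStencil_SpureCombOf tabs cE cVH cΛ j
  obtain ⟨CM, δM, hδM, hM⟩ := tabs.hM j
  obtain ⟨Cw, δw, hδw, hWf⟩ := vertexFamily₂_WcombOf tabs cE cVH cΛ cE₂ cB T j
  have hW : ∀ μ y ν y', Loc (WcombOf tabs cE cVH cΛ cE₂ cB T j μ y ν y') := fun μ y ν y' => ⟨_, _, Cw, δw, hδw, hWf μ y ν y'⟩
  rw [T2RecOf_succ]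
  dsimp only
  rw [SpureCombOf_eq] at hS ⊢
  rw [← WcombOf_eq, e4OfKW_GcombSh_eq_bm_transport j hS hδs hM hδM hW κ u κ' u']

end Comb

end Summit.QuantumFields.BalabanUV.Beta.GAN24.CombQuarticStepTransport

end
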